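import Literature.NumberTheory.Transcendental.HolonomyBoundDen
import Mathlib.RingTheory.PowerSeries.Inverse
import Mathlib.RingTheory.PowerSeries.WellKnown
import Mathlib.Algebra.Polynomial.AlgebraMap
import Mathlib.Tactic
import HarnessLib

/-!
# The symmetrisation `x ↦ y = x + x/(x−1)` and the doubling of denominator types (CDT Lemma 109)

Calegari–Dimitrov–Tang, arXiv:2408.15403, §9 Lemma 109 (= Lemma (etalecover), pp. 92–93) and
its use in §11.2, Lemma 126 (p. 102): with the involution `w(x) = x/(x−1)` of `ℙ¹∖{0,1,∞}` and
`y := x + w(x) = x·w(x) = x²/(x−1)`, the polynomials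
`P_n(y) := xⁿ + (x/(x−1))ⁿ`, `P₀ = 2`, `P₁ = y`, `P_n = y P_{n−1} − y P_{n−2}`,
"have degree `n` and vanish at `y = 0` to order `⌈n/2⌉`", with integer coefficients; hence
for `f = Σ A_k x^k` with `A_k Π_i [1,…,c_i k] ∈ ℤ`, the symmetrisation
`f(x) + f(x/(x−1)) = Σ A_k P_k(y) =: Σ B_n yⁿ` has `B_n Π_i [1,…,2c_i n] ∈ ℤ`
("`P_k(y)` contributes to the `yⁿ` term only for `k ∈ [n, 2n]`"). In §11.2 this gives Lemma 126:
`G = Sym⁺ H` has denominator type `[1,…,2n]²` when `H` has type `[1,…,n]²`.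

This file proves the formal-algebraic content:

* `CalegariDimitrovTang.symPoly n` (`= P_n ∈ ℤ[y]`), `symPoly_natDegree_le`, `X_pow_dvd_symPoly`
  (`y^{⌈n/2⌉} ∣ P_n`), `coeff_symPoly_eq_zero_of_lt` / `_of_gt` (coefficients live in `[⌈n/2⌉, n]`).
* `CalegariDimitrovTang.wSeries = x/(x−1)`, `ySeries = x + x/(x−1)` in `ℚ⟦x⟧`, `ySeries_eq_mul`
  (`y = x · w`), and `aeval_ySeries_symPoly`: **`P_n(y) = xⁿ + w(x)ⁿ`** in `ℚ⟦x⟧`.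
* `CalegariDimitrovTang.symCoeff A n = Σ_{k=n}^{2n} A_k · [yⁿ]P_k` (`= B_n`) and
  `coeff_symmetrization`: for every `N`,
  `[x^N] Σ_{n≤N} B_n yⁿ = [x^N] Σ_{k≤2N} A_k (x^k + w^k)`, i.e. `Σ B_n yⁿ = f(x) + f(w(x))`
  coefficientwise.
* `CalegariDimitrovTang.symCoeff_mul_den_mem` — **the doubling of denominator types**: if
  `A_k · den c k ∈ ℤ` for all `k` then `B_n · den (2c) n ∈ ℤ` (Lemma 109 (2), eq. (nicer);
  Lemma 126 is the case `c = (1,1)`).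

No named facts. (The analytic half of Lemma 109 — continuation on `ℙ¹∖{0,4,∞,T}` with `ℤ/2`
local monodromy at `y = 4` — is not formalised here.)

## References

* [CalegariDimitrovTang2024] arXiv:2408.15403, §9 Lemma 109 and its proof (pp. 92–93); §11.2
  Definition 125, Lemma 126 (p. 102).
-/

noncomputable section

open Polynomial Finset

namespace Literature.NumberTheory.Transcendental

namespace CalegariDimitrovTang

/-! ### The polynomials `P_n(y) = xⁿ + (x/(x−1))ⁿ` -/

/-- `P_n ∈ ℤ[y]`: `P₀ = 2`, `P₁ = y`, `P_{n+2} = y (P_{n+1} − P_n)`.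
[cite: CalegariDimitrovTang2024, §9 proof of Lemma 109, eq. (P_n) (p. 93)] -/
def symPoly : ℕ → ℤ[X]
  | 0 => 2
  | 1 => X
  | n + 2 => X * (symPoly (n + 1) - symPoly n)

/-- `P₀ = 2`. [cite: CalegariDimitrovTang2024, §9 proof of Lemma 109 (p. 93)] -/
@[simp] theorem symPoly_zero : symPoly 0 = 2 := rfl

/-- `P₁ = y`. [cite: CalegariDimitrovTang2024, §9 proof of Lemma 109 (p. 93)] -/
@[simp] theorem symPoly_one : symPoly 1 = X := rfl

/-- The recurrence `P_{n+2} = y P_{n+1} − y P_n`.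
[cite: CalegariDimitrovTang2024, §9 proof of Lemma 109 (p. 93)] -/
theorem symPoly_add_two (n : ℕ) : symPoly (n + 2) = X * (symPoly (n + 1) - symPoly n) := rfl

/-- `deg P_n ≤ n`. [cite: CalegariDimitrovTang2024, §9 proof of Lemma 109 (p. 93)] -/
theorem symPoly_natDegree_le : ∀ n, (symPoly n).natDegree ≤ n
  | 0 => by simp
  | 1 => by simp
  | n + 2 => by
    rw [symPoly_add_two]
    have h1 := symPoly_natDegree_le (n + 1)
    have h0 := symPoly_natDegree_le n
    calc (X * (symPoly (n + 1) - symPoly n)).natDegree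
        ≤ (X : ℤ[X]).natDegree + (symPoly (n + 1) - symPoly n).natDegree := natDegree_mul_le
      _ ≤ 1 + (n + 1) := by
          gcongr
          · exact natDegree_X_le
          · exact (natDegree_sub_le _ _).trans (max_le h1 (h0.trans (Nat.le_succ n)))
      _ = n + 2 := by ring

/-- `y^{⌈n/2⌉} ∣ P_n` ("vanishes at `y = 0` to order `⌈n/2⌉`"; `⌈n/2⌉ = (n+1)/2`).
[cite: CalegariDimitrovTang2024, §9 proof of Lemma 109 (p. 93)] -/
theorem X_pow_dvd_symPoly : ∀ n, (X : ℤ[X]) ^ ((n + 1) / 2) ∣ symPoly n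
  | 0 => by simp
  | 1 => by simp
  | n + 2 => by
    rw [symPoly_add_two]
    have h1 := X_pow_dvd_symPoly (n + 1)
    have h0 := X_pow_dvd_symPoly n
    have e : (n + 2 + 1) / 2 = (n + 1) / 2 + 1 := by omega
    rw [e, pow_succ, mul_comm]
    refine mul_dvd_mul_left _ (dvd_sub ?_ h0)
    exact (pow_dvd_pow _ (by omega)).trans h1

/-- Coefficients of `P_n` above degree `n` vanish. [folklore] -/
theorem coeff_symPoly_eq_zero_of_lt {n j : ℕ} (h : n < j) : (symPoly n).coeff j = 0 :=
  coeff_eq_zero_of_natDegree_lt ((symPoly_natDegree_le n).trans_lt h)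

/-- Coefficients of `P_n` below degree `⌈n/2⌉` vanish. [folklore] -/
theorem coeff_symPoly_eq_zero_of_two_mul_lt {n j : ℕ} (h : 2 * j < n) : (symPoly n).coeff j = 0 := by
  obtain ⟨q, hq⟩ := X_pow_dvd_symPoly n
  rw [hq, coeff_X_pow_mul']
  rw [if_neg (by omega)]

/-! ### `w = x/(x−1)`, `y = x + w = x w` in `ℚ⟦x⟧` and `P_n(y) = xⁿ + wⁿ` -/

/-- `w(x) = x/(x−1) = −x (1 − x)⁻¹ = −(x + x² + x³ + ⋯) ∈ ℚ⟦x⟧`.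
[cite: CalegariDimitrovTang2024, §9 eq. (involutionfirst) (p. 92)] -/
def wSeries : PowerSeries ℚ := -(PowerSeries.X * (1 - PowerSeries.X)⁻¹)

/-- `y = x + w(x) = x²/(x−1) ∈ ℚ⟦x⟧`. [cite: CalegariDimitrovTang2024, §9 eq. (y in x) (p. 92)] -/
def ySeries : PowerSeries ℚ := PowerSeries.X + wSeries

/-- `(1 − x)(1 − x)⁻¹ = 1` in `ℚ⟦x⟧`. [folklore] -/
theorem one_sub_X_mul_inv : (1 - PowerSeries.X : PowerSeries ℚ) * (1 - PowerSeries.X)⁻¹ = 1 :=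
  PowerSeries.mul_inv_cancel _ (by simp)

/-- `y = x + w = x · w` ("the elementary symmetric functions in `x` and `w(x)` are both `y`").
[cite: CalegariDimitrovTang2024, §9 proof of Lemma 109 (p. 93)] -/
theorem ySeries_eq_mul : ySeries = PowerSeries.X * wSeries := by
  unfold ySeries wSeries
  have h := one_sub_X_mul_inv
  -- `x + w = x w ⟺ x (1 − x)⁻¹ ((1 − x) − 1 + x) = 0`
  have key : PowerSeries.X + -(PowerSeries.X * (1 - PowerSeries.X)⁻¹) -
      PowerSeries.X * -(PowerSeries.X * (1 - PowerSeries.X)⁻¹) =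
      PowerSeries.X * (1 - (1 - PowerSeries.X : PowerSeries ℚ) * (1 - PowerSeries.X)⁻¹) := by ring
  rw [h, sub_self, mul_zero, sub_eq_zero] at key
  exact key

/-- **`P_n(y) = xⁿ + w(x)ⁿ`** in `ℚ⟦x⟧`. [cite: CalegariDimitrovTang2024, §9 eq. (P_n) (p. 93)] -/
theorem aeval_ySeries_symPoly : ∀ n,
    aeval ySeries (symPoly n) = PowerSeries.X ^ n + wSeries ^ n
  | 0 => by simp only [symPoly_zero, map_ofNat, pow_zero]; norm_num
  | 1 => by simp [ySeries]
  | n + 2 => by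
    rw [symPoly_add_two, map_mul, map_sub, aeval_X, aeval_ySeries_symPoly (n + 1),
      aeval_ySeries_symPoly n]
    have hy : ySeries = PowerSeries.X + wSeries := rfl
    have hy' := ySeries_eq_mul
    -- `(x + w)(x^{n+1} + w^{n+1}) − x w (xⁿ + wⁿ) = x^{n+2} + w^{n+2}`
    calc ySeries * (PowerSeries.X ^ (n + 1) + wSeries ^ (n + 1) - (PowerSeries.X ^ n + wSeries ^ n))
        = ySeries * (PowerSeries.X ^ (n + 1) + wSeries ^ (n + 1)) -
            ySeries * (PowerSeries.X ^ n + wSeries ^ n) := by ring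
      _ = (PowerSeries.X + wSeries) * (PowerSeries.X ^ (n + 1) + wSeries ^ (n + 1)) -
            PowerSeries.X * wSeries * (PowerSeries.X ^ n + wSeries ^ n) := by
          rw [← hy', ← hy]
      _ = PowerSeries.X ^ (n + 2) + wSeries ^ (n + 2) := by ring

/-! ### The symmetrised coefficients `B_n` and the doubling of denominator types -/

/-- `B_n := Σ_{k=n}^{2n} A_k · [yⁿ] P_k`, the `yⁿ`-coefficient of `Σ_k A_k P_k(y) = f(x) + f(w(x))`.
[cite: CalegariDimitrovTang2024, §9 proof of Lemma 109 (p. 93)] -/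
def symCoeff (A : ℕ → ℚ) (n : ℕ) : ℚ :=
  ∑ k ∈ Icc n (2 * n), A k * ((symPoly k).coeff n : ℚ)

/-- **Doubling of the denominator type under symmetrisation** (CDT Lemma 109 (2), eq. (nicer);
Lemma 126): if `A_k · Π_i [1,…,c_i k] ∈ ℤ` for all `k`, then
`B_n · Π_i [1,…,2 c_i n] ∈ ℤ` for all `n`.
[cite: CalegariDimitrovTang2024, §9 Lemma 109 (2) (pp. 92–93); §11.2 Lemma 126 (p. 102)] -/
theorem symCoeff_mul_den_mem {r : ℕ} (c : Fin r → ℕ) (A : ℕ → ℚ)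
    (hA : ∀ k, ∃ z : ℤ, A k * (HolonomyBound.den c k : ℚ) = z) (n : ℕ) :
    ∃ z : ℤ, symCoeff A n * (HolonomyBound.den (fun i => 2 * c i) n : ℚ) = z := by
  classical
  choose z hz using hA
  -- each term `A_k [yⁿ]P_k · den(2c) n` is an integer since `den c k ∣ den (2c) n` for `k ≤ 2n`
  have hdvd : ∀ k ∈ Icc n (2 * n), HolonomyBound.den c k ∣ HolonomyBound.den (fun i => 2 * c i) n := by
    intro k hk
    have hk2 : k ≤ 2 * n := (mem_Icc.mp hk).2
    unfold HolonomyBound.den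
    refine Finset.prod_dvd_prod_of_dvd _ _ fun i _ => ?_
    unfold Nat.lcmUpto
    exact Finset.lcm_mono (Finset.Icc_subset_Icc_right (by nlinarith))
  have hterm : ∀ k ∈ Icc n (2 * n), ∃ zk : ℤ,
      A k * ((symPoly k).coeff n : ℚ) * (HolonomyBound.den (fun i => 2 * c i) n : ℚ) = zk := by
    intro k hk
    obtain ⟨q, hq⟩ := hdvd k hk
    refine ⟨z k * (symPoly k).coeff n * q, ?_⟩
    rw [hq]
    push_cast
    rw [← hz k]
    ring
  choose! w hw using hterm
  refine ⟨∑ k ∈ Icc n (2 * n), w k, ?_⟩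
  rw [symCoeff, Finset.sum_mul]
  push_cast
  exact Finset.sum_congr rfl fun k hk => hw k hk

/-- **`Σ_n B_n yⁿ = f(x) + f(w(x))` coefficientwise**: for every `N`, the `x^N`-coefficient of
`Σ_{n ≤ N} B_n y(x)ⁿ` equals that of `Σ_{k ≤ 2N} A_k (x^k + w(x)^k)` (all further terms of either
series have `x`-order `> N`, as `ord_x y = ord_x w = 1` and `P_k(y)` involves only `yʲ`, `j ≥ k/2`).
[cite: CalegariDimitrovTang2024, §9 proof of Lemma 109: "`f(x) + f(x/(x−1)) = 2F(y) = Σ A_k P_k(y) =: Σ B_n yⁿ`" (p. 93)] -/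
theorem coeff_symmetrization (A : ℕ → ℚ) (N : ℕ) :
    PowerSeries.coeff N (∑ n ∈ range (N + 1), PowerSeries.C (symCoeff A n) * ySeries ^ n) =
      PowerSeries.coeff N (∑ k ∈ range (2 * N + 1),
        PowerSeries.C (A k) * (PowerSeries.X ^ k + wSeries ^ k)) := by
  classical
  -- rewrite `x^k + w^k = P_k(y) = Σ_j [yʲ]P_k · yʲ`
  have hP : ∀ k, PowerSeries.X ^ k + wSeries ^ k =
      ∑ j ∈ range (k + 1), PowerSeries.C (((symPoly k).coeff j : ℚ)) * ySeries ^ j := by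
    intro k
    rw [← aeval_ySeries_symPoly k, aeval_eq_sum_range' (lt_of_le_of_lt (symPoly_natDegree_le k)
      (Nat.lt_succ_self k))]
    refine Finset.sum_congr rfl fun j _ => ?_
    rw [Algebra.smul_def]
    congr 1
    simp [PowerSeries.C, eq_intCast]
  -- `[x^N] yʲ = 0` for `j > N`
  have hy : ∀ j, N < j → PowerSeries.coeff N (ySeries ^ j) = 0 := by
    intro j hj
    rw [ySeries_eq_mul, mul_pow, PowerSeries.coeff_X_pow_mul', if_neg (not_le.mpr hj)]
  -- the common summand
  set T : ℕ → ℕ → ℚ := fun k j =>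
    A k * ((symPoly k).coeff j : ℚ) * PowerSeries.coeff N (ySeries ^ j) with hT
  -- left-hand side as a double sum over `j ≤ N`, `k ≤ 2N`
  have hL : PowerSeries.coeff N (∑ n ∈ range (N + 1), PowerSeries.C (symCoeff A n) * ySeries ^ n)
      = ∑ j ∈ range (N + 1), ∑ k ∈ range (2 * N + 1), T k j := by
    rw [map_sum]
    refine Finset.sum_congr rfl fun j hj => ?_
    have hjN : j ≤ N := Nat.lt_succ_iff.mp (mem_range.mp hj)
    rw [PowerSeries.coeff_C_mul, symCoeff, Finset.sum_mul]
    -- extend `Icc j (2j)` to `range (2N+1)`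
    apply Finset.sum_subset
    · intro k hk
      rw [mem_Icc] at hk
      exact mem_range.mpr (by omega)
    · intro k hk hk'
      rw [mem_Icc, not_and_or, not_le, not_le] at hk'
      rcases hk' with h | h
      · rw [coeff_symPoly_eq_zero_of_lt h]; simp
      · rw [coeff_symPoly_eq_zero_of_two_mul_lt h]; simp
  -- right-hand side as the same double sum, summed the other way
  have hR : PowerSeries.coeff N (∑ k ∈ range (2 * N + 1),
      PowerSeries.C (A k) * (PowerSeries.X ^ k + wSeries ^ k))
      = ∑ k ∈ range (2 * N + 1), ∑ j ∈ range (N + 1), T k j := by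
    rw [map_sum]
    refine Finset.sum_congr rfl fun k _ => ?_
    rw [hP k, Finset.mul_sum, map_sum]
    have h1 : ∀ j, PowerSeries.coeff N (PowerSeries.C (A k) *
        (PowerSeries.C (((symPoly k).coeff j : ℚ)) * ySeries ^ j)) = T k j := by
      intro j
      simp only [hT, ← mul_assoc, ← map_mul, PowerSeries.coeff_C_mul]
    simp_rw [h1]
    -- both index ranges can be enlarged to `range (N + k + 1)`
    have e1 : ∑ j ∈ range (k + 1), T k j = ∑ j ∈ range (N + k + 1), T k j := by
      apply Finset.sum_subset (range_subset_range.mpr (by omega))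
      intro j hj hj'
      have hkj : k < j := by
        rw [mem_range] at hj hj'; omega
      simp only [hT, coeff_symPoly_eq_zero_of_lt hkj, Int.cast_zero, mul_zero, zero_mul]
    have e2 : ∑ j ∈ range (N + 1), T k j = ∑ j ∈ range (N + k + 1), T k j := by
      apply Finset.sum_subset (range_subset_range.mpr (by omega))
      intro j hj hj'
      have hNj : N < j := by
        rw [mem_range] at hj hj'; omega
      simp only [hT, hy j hNj, mul_zero]
    rw [e1, e2]
  rw [hL, hR, Finset.sum_comm]

end CalegariDimitrovTang

end Literature.NumberTheory.Transcendental
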